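import Summits.CriticalPhenomena.CardyFormulaZ2.Theorems.CardyFlipRussoJitteredTriangularLegUpper
import Literature.Probability.Percolation.TriApproxDomainAssembly

/-!
# `JitteredTriangularLeg` at `σ = 0`: the sandwich (19) at a fixed level, continuum event

Helper file for the support item `JitteredTriangularLeg` (stmt-CriticalPhenomena-6436) of route
`CardyFlipRusso`, continuing `CardyFlipRussoJitteredTriangularLegUpper.lean`.  With the two
continuum sandwich halves in hand, this file repeats for the continuum crossing probability
`P_{1/2}(voronoiCrossing Ω (ab) (cd) δ (𝕋-colouring))` the two layers of the tree that turn them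
into Bollobás–Riordan's (19) at a fixed level (*Percolation* (2006), Ch. 7, Lemma 14 p. 184 with
Claim 20 p. 192): the corner terms of `TriMarkedSandwich.lean`
(`openCrossingProb_le_contProb_add`, `contProb_le_openCrossingProb_add`, copies of
`openCrossingProb_le_triCrossingProb_add` / `triCrossingProb_le_openCrossingProb_add`) and the
level theorems of `TriCollarSandwichLevel.lean` (`cont_level_m`, `cont_level_p`, copies of
`level_m` / `level_p`, the corner terms being `≤ ε/8` by Lemma 4).  The continuum crossing
probability is written with a local notation `contProb[R, δ]`.

## References

* B. Bollobás, O. Riordan, *Percolation*, Cambridge University Press (2006), Ch. 7 Lemma 14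
  p. 184, (19), Claim 20 p. 192, Lemma 4 p. 166, Lemma 5 p. 169, remark p. 195.
-/

noncomputable section

open MeasureTheory Set Metric
open scoped Pointwise

namespace Summit.CriticalPhenomena.CardyFormulaZ2.Theorems

open Literature.Probability.Percolation Literature.Probability.LatticeModels
  Literature.Probability.RandomPlanarGeometry Literature.Topology.PlaneTopology

/-! ### Corner terms: the sandwich for marked discrete domains straddling the arcs (continuum event) -/

section ContLevel

local notation3 "contProb[" R ", " δ "]" => MeasureTheory.Measure.real (sitePercolation (Site 2) half)
  {ω : Set (Site 2) | voronoiCrossing (JordanDomain.carrier (MarkedDomain.toJordanDomain R))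
    (MarkedDomain.arc R 0) (MarkedDomain.arc R 2) δ (triEmbed '' ω) (triEmbed '' ωᶜ)}

/-- **Lower half of (19) with corner terms, continuum event** (copy of
`openCrossingProb_le_triCrossingProb_add` with `real_pathIn_le_real_voronoiCrossing`): under the
straddling hypotheses of `TriMarkedSandwich.lean`, `P(G has an open crossing from arc 0 to arc 2)`
is at most the continuum crossing probability plus the four open corner-annulus terms.
[cite: BollobasRiordan2006, Ch. 7 Lemma 14 (19), Claims 19–20 p. 192, p. 195] -/
theorem openCrossingProb_le_contProb_add (R : ConformalRectangle) :
    ∃ δ₀ > 0, ∃ t₀ > 0, ∀ δ t : ℝ, 0 < δ → δ < δ₀ → 0 ≤ t → t ≤ t₀ → ∀ {ρ r₁ r₂ : ℝ}, ρ ≤ r₁ →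
      ∀ G : TriMarkedDomain 4,
        (∀ x ∈ G.verts, triMeshPoint δ x ∉ R.carrier →
          infDist (triMeshPoint δ x) (R.arc 0) ≤ t ∨ infDist (triMeshPoint δ x) (R.arc 2) ≤ t) →
        (∀ x ∈ G.verts, triMeshPoint δ x ∈ R.carrier → (∀ i, ρ ≤ dist (triMeshPoint δ x) (R.pt i)) →
          δ < infDist (triMeshPoint δ x) (R.arc 1) ∧ δ < infDist (triMeshPoint δ x) (R.arc 3)) →
        (∀ u ∈ G.arc 0, (∀ i, ρ ≤ dist (triMeshPoint δ u) (R.pt i)) →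
          triMeshPoint δ u ∉ R.carrier ∧ infDist (triMeshPoint δ u) (R.arc 0) ≤ t) →
        (∀ v ∈ G.arc 2, (∀ i, ρ ≤ dist (triMeshPoint δ v) (R.pt i)) →
          triMeshPoint δ v ∉ R.carrier ∧ infDist (triMeshPoint δ v) (R.arc 2) ≤ t) →
        (∀ u ∈ G.arc 0, r₂ < dist (triMeshPoint δ u) (R.pt 2) ∧ r₂ < dist (triMeshPoint δ u) (R.pt 3)) →
        (∀ v ∈ G.arc 2, r₂ < dist (triMeshPoint δ v) (R.pt 0) ∧ r₂ < dist (triMeshPoint δ v) (R.pt 1)) →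
        G.openCrossingProb 0 2 ≤ contProb[R, δ] +
          ∑ i : Fin 4, (triSitePercolation half).real (triAnnulusCrossing true δ (R.pt i) r₁ r₂) := by
  classical
  obtain ⟨δ₀, hδ₀, t₀, ht₀, hsand⟩ := real_pathIn_le_real_voronoiCrossing R
  refine ⟨δ₀, hδ₀, t₀, ht₀, fun δ t hδ hδlt ht htle ρ r₁ r₂ hρ G hout hin hU₀ hU₂ hfar0 hfar2 => ?_⟩
  set V : Set (Site 2) := {x | x ∈ G.verts ∧ ∀ i, ρ ≤ dist (triMeshPoint δ x) (R.pt i)} with hV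
  set U₀ : Set (Site 2) := {u | u ∈ G.arc 0 ∧ ∀ i, ρ ≤ dist (triMeshPoint δ u) (R.pt i)} with hU₀def
  set U₂ : Set (Site 2) := {v | v ∈ G.arc 2 ∧ ∀ i, ρ ≤ dist (triMeshPoint δ v) (R.pt i)} with hU₂def
  have hle := hsand δ t hδ hδlt ht htle V U₀ U₂ (fun x hx => hout x hx.1) (fun x hx hxΩ => hin x hx.1 hxΩ hx.2)
    (fun u hu => hU₀ u hu.1 hu.2) (fun v hv => hU₂ v hv.1 hv.2)
  have hsub : G.openCrossing 0 2 ⊆ {ω | ∃ u ∈ U₀, ∃ v ∈ U₂, PathIn triGraph (V ∩ ω) u v} ∪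
      ⋃ i : Fin 4, triAnnulusCrossing true δ (R.pt i) r₁ r₂ := by
    rintro ω ⟨u, hu, v, hv, hP⟩
    obtain ⟨W, hW⟩ := hP.exists_walk
    have hend : ∀ i : Fin 4, r₂ < dist (triMeshPoint δ u) (R.pt i) ∨ r₂ < dist (triMeshPoint δ v) (R.pt i) := by
      intro i
      match i with
      | 0 => exact Or.inr (hfar2 v hv).1
      | 1 => exact Or.inr (hfar2 v hv).2
      | 2 => exact Or.inl (hfar0 u hu).1
      | 3 => exact Or.inl (hfar0 u hu).2
    rcases walk_far_or_annulus R hρ (c := true) (ω := ω) W (fun x hx => by simpa using (hW x hx).2) hend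
      with hfar | ⟨i, hi⟩
    · refine Or.inl ⟨u, ⟨hu, hfar u W.start_mem_support⟩, v, ⟨hv, hfar v W.end_mem_support⟩, ?_⟩
      exact PathIn.of_walk W fun x hx => ⟨⟨(hW x hx).1, hfar x hx⟩, (hW x hx).2⟩
    · exact Or.inr (mem_iUnion.2 ⟨i, hi⟩)
  calc G.openCrossingProb 0 2 = (triSitePercolation half).real (G.openCrossing 0 2) := rfl
    _ ≤ (triSitePercolation half).real ({ω | ∃ u ∈ U₀, ∃ v ∈ U₂, PathIn triGraph (V ∩ ω) u v} ∪
          ⋃ i : Fin 4, triAnnulusCrossing true δ (R.pt i) r₁ r₂) := measureReal_mono hsub (measure_ne_top _ _)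
    _ ≤ (triSitePercolation half).real {ω | ∃ u ∈ U₀, ∃ v ∈ U₂, PathIn triGraph (V ∩ ω) u v} +
          (triSitePercolation half).real (⋃ i : Fin 4, triAnnulusCrossing true δ (R.pt i) r₁ r₂) := measureReal_union_le _ _
    _ ≤ contProb[R, δ] +
          ∑ i : Fin 4, (triSitePercolation half).real (triAnnulusCrossing true δ (R.pt i) r₁ r₂) := by
        gcongr
        · exact hle
        · exact measureReal_iUnion_fintype_le _

/-- **Upper half of (19) with corner terms, continuum event** (copy of
`triCrossingProb_le_openCrossingProb_add` with `real_voronoiCrossing_le_real_not_pathIn`): the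
continuum crossing probability is at most `P(G has an open crossing from arc 0 to arc 2)` plus the
four closed corner-annulus terms (Lemma 5 in `G`). [cite: BollobasRiordan2006, Ch. 7 Lemma 14 (19), Claims 19–20 p. 192, p. 195, Lemma 5] -/
theorem contProb_le_openCrossingProb_add (R : ConformalRectangle) {ρ : ℝ} :
    ∃ δ₀ > 0, ∃ t₀ > 0, ∀ δ t : ℝ, 0 < δ → δ < δ₀ → 0 ≤ t → t ≤ t₀ → ∀ {r₁ r₂ : ℝ}, ρ ≤ r₁ →
      ∀ G : TriMarkedDomain 4,
        (∀ x ∈ G.verts, triMeshPoint δ x ∉ R.carrier →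
          infDist (triMeshPoint δ x) (R.arc 1) ≤ t ∨ infDist (triMeshPoint δ x) (R.arc 3) ≤ t) →
        (∀ x ∈ G.verts, triMeshPoint δ x ∈ R.carrier → (∀ i, ρ ≤ dist (triMeshPoint δ x) (R.pt i)) →
          δ < infDist (triMeshPoint δ x) (R.arc 0) ∧ δ < infDist (triMeshPoint δ x) (R.arc 2)) →
        (∀ u ∈ G.arc 1, (∀ i, ρ ≤ dist (triMeshPoint δ u) (R.pt i)) →
          triMeshPoint δ u ∉ R.carrier ∧ infDist (triMeshPoint δ u) (R.arc 1) ≤ t) →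
        (∀ v ∈ G.arc 3, (∀ i, ρ ≤ dist (triMeshPoint δ v) (R.pt i)) →
          triMeshPoint δ v ∉ R.carrier ∧ infDist (triMeshPoint δ v) (R.arc 3) ≤ t) →
        (∀ u ∈ G.arc 1, r₂ < dist (triMeshPoint δ u) (R.pt 3) ∧ r₂ < dist (triMeshPoint δ u) (R.pt 0)) →
        (∀ v ∈ G.arc 3, r₂ < dist (triMeshPoint δ v) (R.pt 1) ∧ r₂ < dist (triMeshPoint δ v) (R.pt 2)) →
        contProb[R, δ] ≤ G.openCrossingProb 0 2 +
          ∑ i : Fin 4, (triSitePercolation half).real (triAnnulusCrossing false δ (R.pt i) r₁ r₂) := by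
  classical
  obtain ⟨δ₀, hδ₀, t₀, ht₀, hsand⟩ := real_voronoiCrossing_le_real_not_pathIn R
  refine ⟨δ₀, hδ₀, t₀, ht₀, fun δ t hδ hδlt ht htle r₁ r₂ hρ G hout hin hU₁ hU₃ hfar1 hfar3 => ?_⟩
  set V : Set (Site 2) := {x | x ∈ G.verts ∧ ∀ i, ρ ≤ dist (triMeshPoint δ x) (R.pt i)} with hV
  set U₁ : Set (Site 2) := {u | u ∈ G.arc 1 ∧ ∀ i, ρ ≤ dist (triMeshPoint δ u) (R.pt i)} with hU₁def
  set U₃ : Set (Site 2) := {v | v ∈ G.arc 3 ∧ ∀ i, ρ ≤ dist (triMeshPoint δ v) (R.pt i)} with hU₃def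
  have hle := hsand δ t hδ hδlt ht htle V U₁ U₃ (fun x hx => hout x hx.1) (fun x hx hxΩ => hin x hx.1 hxΩ hx.2)
    (fun u hu => hU₁ u hu.1 hu.2) (fun v hv => hU₃ v hv.1 hv.2)
  have hsub : {ω : SiteConfig (Site 2) | ¬ ∃ u ∈ U₁, ∃ v ∈ U₃, PathIn triGraph (V ∩ ωᶜ) u v} ⊆
      G.openCrossing 0 2 ∪ ⋃ i : Fin 4, triAnnulusCrossing false δ (R.pt i) r₁ r₂ := by
    intro ω hω
    by_cases hcl : G.IsClosedCrossing ω 1 3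
    · obtain ⟨u, hu, v, hv, hP⟩ := hcl
      obtain ⟨W, hW⟩ := hP.exists_walk
      have hend : ∀ i : Fin 4, r₂ < dist (triMeshPoint δ u) (R.pt i) ∨ r₂ < dist (triMeshPoint δ v) (R.pt i) := by
        intro i
        match i with
        | 0 => exact Or.inl (hfar1 u hu).2
        | 1 => exact Or.inr (hfar3 v hv).1
        | 2 => exact Or.inr (hfar3 v hv).2
        | 3 => exact Or.inl (hfar1 u hu).1
      rcases walk_far_or_annulus R hρ (c := false) (ω := ω) W (fun x hx => by simpa using (hW x hx).2) hend
        with hfar | ⟨i, hi⟩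
      · exfalso
        refine hω ⟨u, ⟨hu, fun i => hfar u W.start_mem_support i⟩, v, ⟨hv, fun i => hfar v W.end_mem_support i⟩, ?_⟩
        exact PathIn.of_walk W fun x hx => ⟨⟨(hW x hx).1, fun i => hfar x hx i⟩, (hW x hx).2⟩
      · exact Or.inr (mem_iUnion.2 ⟨i, hi⟩)
    · exact Or.inl (((tri_markedDomain_duality_holds G ω).or).resolve_right hcl)
  calc contProb[R, δ]
      ≤ (triSitePercolation half).real {ω | ¬ ∃ u ∈ U₁, ∃ v ∈ U₃, PathIn triGraph (V ∩ ωᶜ) u v} := hle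
    _ ≤ (triSitePercolation half).real (G.openCrossing 0 2 ∪ ⋃ i : Fin 4, triAnnulusCrossing false δ (R.pt i) r₁ r₂) :=
        measureReal_mono hsub (measure_ne_top _ _)
    _ ≤ (triSitePercolation half).real (G.openCrossing 0 2) +
          (triSitePercolation half).real (⋃ i : Fin 4, triAnnulusCrossing false δ (R.pt i) r₁ r₂) := measureReal_union_le _ _
    _ ≤ G.openCrossingProb 0 2 + ∑ i : Fin 4, (triSitePercolation half).real (triAnnulusCrossing false δ (R.pt i) r₁ r₂) := by
        gcongr
        · exact le_rfl
        · exact measureReal_iUnion_fintype_le _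

/-! ### The sandwich at a fixed level and the discrete approximation (continuum event) -/

variable (R : ConformalRectangle) (T : R.toJordanDomain.TubeData)

/-- **Level `ε`, lower half, continuum event** (copy of `level_m`). [cite: BollobasRiordan2006, Ch. 7 Lemma 14 (19) p. 184, Claim 20 p. 192] -/
theorem cont_level_m (hR1 : ∀ z ∈ R.carrier, R.index z = 1) {ε : ℝ} (hε : 0 < ε) :
    ∃ (h : ℝ) (hh : 0 < h) (hh1 : h ≤ 1 / 2), h ≤ ε ∧
      T.z₀ ∈ (R.collarRect T (MarkedDomain.abs_le_one_of_sign σm_sign) hh hh1).carrier ∧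
      ∃ δ₀ > 0, ∀ δ : ℝ, ∀ hδ : 0 < δ, δ < δ₀ →
        ∃ hc₀ : baseSite T.z₀ δ ∈ innerCoarse (R.collarRect T (MarkedDomain.abs_le_one_of_sign σm_sign) hh hh1).carrier δ,
        ∃ G : TriMarkedDomain 4,
          G.verts = (innerApprox (R.collarRect T (MarkedDomain.abs_le_one_of_sign σm_sign) hh hh1).toJordanDomain hδ hc₀).verts ∧
          (∀ i : Fin 4, (∀ y ∈ G.arc i, ∃ z ∈ R.arc i, dist (triMeshPoint δ y) z < 2 * ε) ∧
            ∀ z ∈ R.arc i, ∃ y ∈ G.arc i, dist (triMeshPoint δ y) z < 2 * ε) ∧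
          (∀ x : Site 2, triMeshPoint δ x ∈ T.Ci.Φ '' closedBall (0 : ℂ) (1 - 2 * ε) → x ∈ G.verts) ∧
          (∀ z ∈ closure R.carrier, ∃ w ∈ G.faces, dist z ((δ : ℂ) * hexCenter w) < 2 * ε) ∧
          G.openCrossingProb 0 2 ≤ contProb[R, δ] + ε := by
  classical
  obtain ⟨carc, hcarc0, hcarc⟩ := R.exists_pos_le_infDist_pt_arc
  obtain ⟨α, hα, hbound⟩ := tri_annulusCrossing_bound_holds
  set ε' := min ε (carc / 4) with hε'
  have hε'0 : 0 < ε' := lt_min hε (by linarith)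
  have hε'ε : ε' ≤ ε := min_le_left _ _
  have hε'c : ε' ≤ carc / 4 := min_le_right _ _
  set r₂ := carc / 3 with hr₂
  obtain ⟨ρ, hρ, hρε, hρr, hρα⟩ := exists_corner_radius (r₂ := r₂) hα (by positivity) hε'0
  obtain ⟨δS, hδS, t₀, ht₀, hsand⟩ := openCrossingProb_le_contProb_add R
  obtain ⟨h, hh, hh1, hhε, hz₀, δ₀, hδ₀, t, ht0, htt₀, hlev⟩ := level_core R T σm_sign hR1 hε'0 hρ ht₀ hcarc
  refine ⟨h, hh, hh1, hhε.trans hε'ε, hz₀, min δ₀ (min δS (ρ / 1000)), by positivity, fun δ hδ hδlt => ?_⟩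
  have hδ₀' : δ < δ₀ := hδlt.trans_le (min_le_left _ _)
  have hδS' : δ < δS := hδlt.trans_le ((min_le_right _ _).trans (min_le_left _ _))
  obtain ⟨hc₀, G, hGv, harcs, H1, H2, H3, H4, hfill, hdense⟩ := hlev δ hδ hδ₀'
  refine ⟨hc₀, G, hGv, fun i => ⟨fun y hy => ?_, fun z hz => ?_⟩, fun x hx => hfill x ?_, fun z hz => ?_, ?_⟩
  · obtain ⟨z, hz, hd⟩ := (harcs i).1 y hy; exact ⟨z, hz, by linarith⟩
  · obtain ⟨y, hy, hd⟩ := (harcs i).2 z hz; exact ⟨y, hy, by linarith⟩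
  · obtain ⟨u, hu, hux⟩ := hx
    exact ⟨u, closedBall_subset_closedBall (by linarith) hu, hux⟩
  · obtain ⟨w, hw, hd⟩ := hdense z hz; exact ⟨w, hw, by linarith⟩
  have hσ0 : σm 0 = 1 := by simp [σm]
  have hσ2 : σm 2 = 1 := by simp [σm]
  have hσ1' : σm 1 = -1 := by simp [σm]
  have hσ3 : σm 3 = -1 := by simp [σm]
  have key := hsand δ t hδ hδS' ht0 htt₀ (ρ := ρ) (r₁ := ρ) (r₂ := r₂) le_rfl G
    (fun x hx hxΩ => by
      obtain ⟨i, hi, hd⟩ := H1 x hx hxΩ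
      rcases σm_eq_one_iff.1 hi with rfl | rfl
      · exact Or.inl hd
      · exact Or.inr hd)
    (fun x hx hxΩ hfar => ⟨H2 x hx hxΩ hfar 1 hσ1', H2 x hx hxΩ hfar 3 hσ3⟩)
    (fun u hu hfar => H3 0 hσ0 u hu hfar) (fun v hv hfar => H3 2 hσ2 v hv hfar)
    (fun u hu => ⟨by linarith [H4 0 u hu 2 (by rw [R.pt_mem_arc_iff]; decide)],
      by linarith [H4 0 u hu 3 (by rw [R.pt_mem_arc_iff]; decide)]⟩)
    (fun v hv => ⟨by linarith [H4 2 v hv 0 (by rw [R.pt_mem_arc_iff]; decide)],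
      by linarith [H4 2 v hv 1 (by rw [R.pt_mem_arc_iff]; decide)]⟩)
  have hδρ : δ < ρ / 1000 := hδlt.trans_le ((min_le_right _ _).trans (min_le_right _ _))
  have hcorner : ∀ i : Fin 4, (triSitePercolation half).real (triAnnulusCrossing true δ (R.pt i) ρ r₂) ≤ (ρ / r₂) ^ α :=
    fun i => hbound true δ (R.pt i) ρ r₂ hδ (by linarith) hρr
  have hsum := sum_fin_four_le hcorner
  exact key.trans (by linarith)

/-- **Level `ε`, upper half, continuum event** (copy of `level_p`). [cite: BollobasRiordan2006, Ch. 7 Lemma 14 (19) p. 184, Claim 20 p. 192, Lemma 5] -/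
theorem cont_level_p (hR1 : ∀ z ∈ R.carrier, R.index z = 1) {ε : ℝ} (hε : 0 < ε) :
    ∃ (h : ℝ) (hh : 0 < h) (hh1 : h ≤ 1 / 2), h ≤ ε ∧
      T.z₀ ∈ (R.collarRect T (MarkedDomain.abs_le_one_of_sign σp_sign) hh hh1).carrier ∧
      ∃ δ₀ > 0, ∀ δ : ℝ, ∀ hδ : 0 < δ, δ < δ₀ →
        ∃ hc₀ : baseSite T.z₀ δ ∈ innerCoarse (R.collarRect T (MarkedDomain.abs_le_one_of_sign σp_sign) hh hh1).carrier δ,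
        ∃ G : TriMarkedDomain 4,
          G.verts = (innerApprox (R.collarRect T (MarkedDomain.abs_le_one_of_sign σp_sign) hh hh1).toJordanDomain hδ hc₀).verts ∧
          (∀ i : Fin 4, (∀ y ∈ G.arc i, ∃ z ∈ R.arc i, dist (triMeshPoint δ y) z < 2 * ε) ∧
            ∀ z ∈ R.arc i, ∃ y ∈ G.arc i, dist (triMeshPoint δ y) z < 2 * ε) ∧
          (∀ x : Site 2, triMeshPoint δ x ∈ T.Ci.Φ '' closedBall (0 : ℂ) (1 - 2 * ε) → x ∈ G.verts) ∧
          (∀ z ∈ closure R.carrier, ∃ w ∈ G.faces, dist z ((δ : ℂ) * hexCenter w) < 2 * ε) ∧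
          contProb[R, δ] ≤ G.openCrossingProb 0 2 + ε := by
  classical
  obtain ⟨carc, hcarc0, hcarc⟩ := R.exists_pos_le_infDist_pt_arc
  obtain ⟨α, hα, hbound⟩ := tri_annulusCrossing_bound_holds
  set ε' := min ε (carc / 4) with hε'
  have hε'0 : 0 < ε' := lt_min hε (by linarith)
  have hε'ε : ε' ≤ ε := min_le_left _ _
  have hε'c : ε' ≤ carc / 4 := min_le_right _ _
  set r₂ := carc / 3 with hr₂
  obtain ⟨ρ, hρ, hρε, hρr, hρα⟩ := exists_corner_radius (r₂ := r₂) hα (by positivity) hε'0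
  obtain ⟨δS, hδS, t₀, ht₀, hsand⟩ := contProb_le_openCrossingProb_add R (ρ := ρ)
  obtain ⟨h, hh, hh1, hhε, hz₀, δ₀, hδ₀, t, ht0, htt₀, hlev⟩ := level_core R T σp_sign hR1 hε'0 hρ ht₀ hcarc
  refine ⟨h, hh, hh1, hhε.trans hε'ε, hz₀, min δ₀ (min δS (ρ / 1000)), by positivity, fun δ hδ hδlt => ?_⟩
  have hδ₀' : δ < δ₀ := hδlt.trans_le (min_le_left _ _)
  have hδS' : δ < δS := hδlt.trans_le ((min_le_right _ _).trans (min_le_left _ _))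
  obtain ⟨hc₀, G, hGv, harcs, H1, H2, H3, H4, hfill, hdense⟩ := hlev δ hδ hδ₀'
  refine ⟨hc₀, G, hGv, fun i => ⟨fun y hy => ?_, fun z hz => ?_⟩, fun x hx => hfill x ?_, fun z hz => ?_, ?_⟩
  · obtain ⟨z, hz, hd⟩ := (harcs i).1 y hy; exact ⟨z, hz, by linarith⟩
  · obtain ⟨y, hy, hd⟩ := (harcs i).2 z hz; exact ⟨y, hy, by linarith⟩
  · obtain ⟨u, hu, hux⟩ := hx
    exact ⟨u, closedBall_subset_closedBall (by linarith) hu, hux⟩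
  · obtain ⟨w, hw, hd⟩ := hdense z hz; exact ⟨w, hw, by linarith⟩
  have hσ1 : σp 1 = 1 := by simp [σp]
  have hσ3 : σp 3 = 1 := by simp [σp]
  have hσ0 : σp 0 = -1 := by simp [σp]
  have hσ2 : σp 2 = -1 := by simp [σp]
  have key := hsand δ t hδ hδS' ht0 htt₀ (r₁ := ρ) (r₂ := r₂) le_rfl G
    (fun x hx hxΩ => by
      obtain ⟨i, hi, hd⟩ := H1 x hx hxΩ
      rcases σp_eq_one_iff.1 hi with rfl | rfl
      · exact Or.inl hd
      · exact Or.inr hd)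
    (fun x hx hxΩ hfar => ⟨H2 x hx hxΩ hfar 0 hσ0, H2 x hx hxΩ hfar 2 hσ2⟩)
    (fun u hu hfar => H3 1 hσ1 u hu hfar) (fun v hv hfar => H3 3 hσ3 v hv hfar)
    (fun u hu => ⟨by linarith [H4 1 u hu 3 (by rw [R.pt_mem_arc_iff]; decide)],
      by linarith [H4 1 u hu 0 (by rw [R.pt_mem_arc_iff]; decide)]⟩)
    (fun v hv => ⟨by linarith [H4 3 v hv 1 (by rw [R.pt_mem_arc_iff]; decide)],
      by linarith [H4 3 v hv 2 (by rw [R.pt_mem_arc_iff]; decide)]⟩)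
  have hδρ : δ < ρ / 1000 := hδlt.trans_le ((min_le_right _ _).trans (min_le_right _ _))
  have hcorner : ∀ i : Fin 4, (triSitePercolation half).real (triAnnulusCrossing false δ (R.pt i) ρ r₂) ≤ (ρ / r₂) ^ α :=
    fun i => hbound false δ (R.pt i) ρ r₂ hδ (by linarith) hρr
  have hsum := sum_fin_four_le hcorner
  exact key.trans (by linarith)

end ContLevel

end Summit.CriticalPhenomena.CardyFormulaZ2.Theorems

end
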